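import Literature.NumberTheory.EllipticCurves.HidaFamilyMembersProofs
import Literature.NumberTheory.EllipticCurves.CaiShuTian2014.HeegnerConditionProofs
import Literature.NumberTheory.EllipticCurves.PAdicBSDSplitMultiplicativeProofs
import Literature.NumberTheory.EllipticCurves.PAdicLFunctionNonsplitMultiplicativeExistenceProofs
import HarnessLib

/-!
# Congruent GOOD-ordinary newforms in higher weight through a `p`-NEW weight-two point: the
# classical (Deligne–Serre + `p`-stabilisation) half of
# `hida_exists_congruent_ordinary_newform_of_multiplicative` (proofs only)

Topic `Literature/NumberTheory/EllipticCurves`; namespaces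
`Literature.NumberTheory.EllipticCurves.ModularForms` (modular forms) and
`Literature.NumberTheory.EllipticCurves` (elliptic curves).  THEOREMS ONLY (no definition, no named
fact; D-0026).  The multiplicative-reduction twin of `HidaFamilyMembersProofs.lean`
(`exists_isNewform0_dvd_conductorNorm_congr_of_exists_isNewformOf`: the GOOD ordinary base point),
for the named fact `hida_exists_congruent_ordinary_newform_of_multiplicative`
(`HidaFamilyMembers.lean`; Hida 1986 / Emerton–Pollack–Weston 2006, Thm. 2.1.2, Thm. 2.2.2, §2.1,
Ex. 5.3.1: for `E/ℚ` of conductor `N = Mp`, `p ‖ N`, `p ≥ 5`, and `k > 2`, `k ≡ 2 (mod p − 1)`, a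
`p`-ordinary newform `g ∈ S_k(Γ₀(N/p))` congruent to `f_E`) — the binder `hHida` = step [L1] of the
BSD residual cell's X11a chain (`Summits/BirchSwinnertonDyer/Rank1Residual/X11a/ChainBounded*.lean`).

As for the good case, the printed derivation has two layers:

1. (classical; Deligne–Serre 1974, 6.9–6.11, and "`p`-stabilisation backwards", Hida EMI Cor.
   4.1.30 / Miyake Thm. 4.6.17) in weight `k` there is SOME `p`-ordinary newform of level `M′ ∣ N/p`
   (prime to `p`!) congruent to `f_E` at every prime `ℓ ∤ N`: multiply `f_E ∈ S_2(Γ₀(Mp))` by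
   `E_{k-2} ≡ 1 (mod p)`, lift the mod-`p` eigenvector `f_E E_{k-2}` of ALL the Hecke operators of
   level `Mp` — INCLUDING `U_p`, whose action on `q`-expansions at a level divisible by `p` has no
   weight dependence, with eigenvalue `a_p(E) = ±1`, a unit — by the Deligne–Serre lemma to a genuine
   eigenform `F ∈ S_k(Γ₀(Mp))`; since `k > 2` and the `U_p`-eigenvalue is a unit, `F` is `p`-OLD
   (a `p`-new form of weight `k > 2` has `a_p² = p^{k-2}`, not a unit) and comes from a newform `g`
   of level `M′ ∣ M = N/p` with `u² − a_p(g)u + p^{k−1} = 0`, so `a_p(g) ≡ u` is a unit;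
2. (`Λ`-adic, Hida 1986; EPW 2006 Thm. 2.2.2 (2)) the level is EXACTLY `N/p` — constancy of the
   tame conductor along the branch of `𝕋_{N/p}^{new}` through `f_E`, equivalently level RAISING in
   weight `k` (Diamond–Taylor) at the primes `q ‖ N/p` where `E[p]` is unramified
   (`p ∣ ord_q Δ`).

This file PROVES layer 1 for the `p`-new base point — the tree already holds every ingredient: the
Deligne–Serre machinery of `HidaFamilyMembersProofs.lean` (whose main lifting step is re-run here
keeping ALL Hecke operators, `U_q` for `q ∣ N` included, instead of discarding them when passing
to the newform), the `p`-old descent lemmas `exists_isNewform0_mem_span_of_eigenpacket`,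
`heckeT_eq_smul_of_mem_span_of_dvd`, `heckeT_heckeT_sub_add_eq_zero_of_mem_span_of_not_dvd`,
`IsNewform0.coeff_sq_eq_of_exactly_dvd` (stated for any level `L` with `p ‖ L`), and the
dictionary `a_p(f_E) = ±1` at a multiplicative prime
(`IsNewformOf.cuspCoeff_eq_one_and_sq_of_split`, `IsNewformOf.cuspCoeff_eq_neg_one_and_dvd_of_nonsplit`),
`a_ℓ(f_E) = a_ℓ(E)` at good `ℓ`, `p ‖ N` at a multiplicative prime
(`factorization_conductorNorm_eq_one_of_hasMultiplicativeReductionAtPrime`):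

* `Literature.NumberTheory.EllipticCurves.ModularForms.exists_eigenform0_congr_of_isNewform0` —
  for a newform `f ∈ S_{k₀}(Γ₀(N))`, `k₀ ≥ 2`, ANY prime `p`, `ι : ℚ̄_p ≃ ℂ`, even `w ≥ 3` with
  `(p − 1) ∣ w`: a non-zero `F ∈ S_{k₀+w}(Γ₀(N))`, eigenform of EVERY `T_q` (`q` prime; `= U_q`
  for `q ∣ N`) with eigenvalues congruent to `a_q(f)` modulo `𝔪_{ℚ̄_p}` — the Deligne–Serre lift
  before the passage to a newform (which `exists_isNewform0_dvd_level_congr` performs, losing the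
  `U_q`);
* `Literature.NumberTheory.EllipticCurves.ModularForms.exists_isNewform0_of_ordinary_eigenform_of_exactly_dvd`
  — `p`-stabilisation backwards at a level `L` with `p ‖ L` (`p ∣ L`, `p² ∤ L`), `k > 2`: a non-zero
  eigenform of the `T_q` (`q ∤ L`) and of `U_p` with unit `U_p`-eigenvalue comes from a newform `g`
  of level `M′ ∣ L` PRIME TO `p` with `u² − a_p(g)u + p^{k−1} = 0` and `|ι⁻¹ a_p(g)|_p = 1` (the
  tree's `exists_isNewform0_of_ordinary_pStabilised`, restated from level `N·p` to any `L` with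
  `p ‖ L`; same proof);
* `Literature.NumberTheory.EllipticCurves.exists_isNewform0_dvd_conductorNorm_div_congr_of_multiplicative_of_exists_isNewformOf`
  — granted the Modularity Theorem (`exists_isNewformOf`; BCDT 2001 Thm. A), the statement of
  `hida_exists_congruent_ordinary_newform_of_multiplicative` with "newform of level `N/p`" replaced
  by "newform of some level `M′ ∣ N/p`": `|ι a_p(g)|_p = 1` and `|ι a_ℓ(g) − a_ℓ(E)|_p < 1` for all
  primes `ℓ ∤ N`.

So, exactly as for the good ordinary base point, the ONLY unformalised content of the named fact
`hida_exists_congruent_ordinary_newform_of_multiplicative` is "the level is exactly `N/p`"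
(Hida 1986 Cor. 1.3 / EPW Thm. 2.2.2 (2), or Diamond–Taylor level raising); no `_holds` is claimed.
Remark for the consumer (the X11a chain): Emerton–Pollack–Weston's family `H(ρ̄)` contains members
of every tame level and Wan 2015 Thm. 4 needs only `p ∤ M′`; the member facts of the chain are
typed at level `N/p` (`IsOrdinaryMemberOf`), which is why the exact level is still consumed there.

## References

* P. Deligne, J.-P. Serre, *Formes modulaires de poids 1*, Ann. Sci. ÉNS (4) 7 (1974), 507–530,
  6.9–6.11. [DeligneSerreASENS1974]
* F. Diamond, J. Shurman, *A First Course in Modular Forms*, GTM 228 (2005), Prop. 5.6.2,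
  Prop. 5.8.5, Thm. 5.8.2–5.8.3, §5.1–5.2, Exercise 5.2.4. [DiamondShurman2005]
* H. Hida, *Elementary Modular Iwasawa Theory*, World Scientific (2022), §4.1, Cor. 4.1.30. [Hida2022EMI]
* H. Hida, *Galois representations into `GL₂(ℤ_p[[X]])` attached to ordinary cusp forms*,
  Invent. Math. 85 (1986), 545–613. [Hida1986]
* M. Emerton, R. Pollack, T. Weston, *Variation of Iwasawa invariants in Hida families*, Invent.
  Math. 163 (2006), 523–580, Thm. 2.1.2, Thm. 2.2.2, §2.1, Ex. 5.3.1. [EmertonPollackWeston2006]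
* J. H. Silverman, *The Arithmetic of Elliptic Curves*, GTM 106 (2009), §C.16. [SilvermanAEC2009]
* C. Breuil, B. Conrad, F. Diamond, R. Taylor, *On the modularity of elliptic curves over `ℚ`*,
  J. Amer. Math. Soc. 14 (2001), Thm. A. [BreuilConradDiamondTaylor2001]
-/

noncomputable section

open scoped MatrixGroups ModularForm
open CongruenceSubgroup UpperHalfPlane

namespace Literature.NumberTheory.EllipticCurves.ModularForms

/-! ### Norm bookkeeping in `ℚ̄_p` (private copies of the helpers of `HidaFamilyMembersProofs`) -/


section Norm

variable {p : ℕ} [Fact p.Prime]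

/-- Chaining two congruences modulo `𝔪`. [folklore] -/
private theorem norm_sub_lt_one_trans {x y z : PadicAlgCl p} (h₁ : ‖x - y‖ < 1)
    (h₂ : ‖y - z‖ < 1) : ‖x - z‖ < 1 := by
  have : x - z = (x - y) + (y - z) := by ring
  rw [this]
  exact (PadicAlgCl.isNonarchimedean p _ _).trans_lt (max_lt h₁ h₂)

/-- Ultrametric inequality for differences. [folklore] -/
private theorem norm_sub_le_max' (x y : PadicAlgCl p) : ‖x - y‖ ≤ max ‖x‖ ‖y‖ := by
  have h := PadicAlgCl.isNonarchimedean p x (-y)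
  rwa [norm_neg, ← sub_eq_add_neg] at h

/-- An element congruent to an element of norm `1` has norm `1`. [folklore] -/
private theorem norm_eq_one_of_norm_sub_lt_one {x y : PadicAlgCl p} (hy : ‖y‖ = 1)
    (h : ‖x - y‖ < 1) : ‖x‖ = 1 := by
  apply le_antisymm
  · have h1 : x = (x - y) + y := by ring
    rw [h1]
    exact (PadicAlgCl.isNonarchimedean p _ _).trans (max_le h.le hy.le)
  · by_contra hlt
    push Not at hlt
    have h1 : y = x - (x - y) := by ring
    have h2 : ‖y‖ < 1 := by
      rw [h1]
      have h3 := PadicAlgCl.isNonarchimedean p x (-(x - y))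
      rw [norm_neg, ← sub_eq_add_neg] at h3
      exact h3.trans_lt (max_lt hlt h)
    rw [hy] at h2
    exact lt_irrefl _ h2

/-- **Algebraic integers of `ℚ̄_p` have norm at most one** (the valuation ring of `ℚ̄_p` is
integrally closed and contains `ℤ`). [folklore] -/
private theorem norm_le_one_of_isIntegral {x : PadicAlgCl p} (hx : IsIntegral ℤ x) :
    ‖x‖ ≤ 1 := by
  have hv := Valuation.integer.integers (Valued.v (R := PadicAlgCl p))
  have hx' : IsIntegral (Valued.v (R := PadicAlgCl p)).integer x := hx.tower_top
  have h := (hv.isIntegral_iff_v_le_one).mp hx'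
  rw [PadicAlgCl.valuation_def] at h
  exact_mod_cast h

/-- `‖p‖ < 1` in `ℚ̄_p`. [folklore] -/
private theorem norm_natCast_prime_lt_one : ‖(p : PadicAlgCl p)‖ < 1 := by
  rw [← map_natCast (algebraMap ℚ_[p] (PadicAlgCl p)) p]
  change ‖((p : ℚ_[p]) : PadicAlgCl p)‖ < 1
  rw [PadicAlgCl.norm_extends]
  exact Padic.norm_p_lt_one

/-- An integer divisible by `p` has norm `< 1` in `ℚ̄_p`. [folklore] -/
private theorem norm_intCast_lt_one_of_dvd {z : ℤ} (hz : (p : ℤ) ∣ z) :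
    ‖(z : PadicAlgCl p)‖ < 1 := by
  rw [← map_intCast (algebraMap ℚ_[p] (PadicAlgCl p)) z]
  change ‖((z : ℚ_[p]) : PadicAlgCl p)‖ < 1
  rw [PadicAlgCl.norm_extends]
  exact Padic.norm_intCast_lt_one_iff.2 hz

/-- A rational number of `p`-adic valuation `< 1` (an element of `p ℤ_{(p)}`) has norm `< 1` in
`ℚ̄_p`. [folklore] -/
private theorem norm_ratCast_lt_one {r : ℚ} (hr : Rat.padicValuation p r < 1) :
    ‖(r : PadicAlgCl p)‖ < 1 := by
  have hp : p.Prime := Fact.out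
  have hnum := (DeligneSerre1974.padicValuation_lt_one_iff_dvd_num r).mp hr
  have hden : ¬ (p : ℤ) ∣ (r.den : ℤ) := by
    intro h
    have h1 : p ∣ r.num.natAbs := Int.natCast_dvd.mp hnum
    have h2 : p ∣ r.num.natAbs.gcd r.den := Nat.dvd_gcd h1 (Int.natCast_dvd_natCast.mp h)
    rw [r.reduced.gcd_eq_one] at h2
    exact hp.ne_one (Nat.dvd_one.mp h2)
  have hr' : (r : PadicAlgCl p) = (r.num : PadicAlgCl p) / (r.den : ℤ) := by
    rw [Int.cast_natCast]
    exact_mod_cast (Rat.num_div_den r).symm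
  rw [hr', norm_div, DeligneSerreLift.norm_intCast_eq_one_of_not_dvd hden, div_one]
  exact norm_intCast_lt_one_of_dvd hnum

/-- A finite sum of elements of norm `< 1` has norm `< 1` (ultrametric inequality). [folklore] -/
private theorem norm_sum_lt_one {α : Type*} (s : Finset α) (u : α → PadicAlgCl p)
    (h : ∀ a ∈ s, ‖u a‖ < 1) : ‖∑ a ∈ s, u a‖ < 1 := by
  rcases s.eq_empty_or_nonempty with rfl | hs
  · simp
  · obtain ⟨a, ha, hle⟩ := IsUltrametricDist.exists_norm_finsetSum_le_of_nonempty hs u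
    exact hle.trans_lt (h a ha)

end Norm

/-! ### The classical half: a congruent newform of level dividing `N` in every admissible weight -/


/-! ### The Deligne–Serre lift keeping ALL Hecke operators -/

section DeligneSerre

variable {p : ℕ} [Fact p.Prime]

/-- **Congruent eigenforms in higher weight, ALL Hecke operators kept (Deligne–Serre).**  Let `p`
be a prime, `ι : ℚ̄_p ≃ ℂ`, `f ∈ S_{k₀}(Γ₀(N))` a newform of weight `k₀ ≥ 2`, and `w ≥ 3` an even
integer divisible by `p − 1`.  Then there are a non-zero `F ∈ S_{k₀+w}(Γ₀(N))` and `c : ℕ → ℂ`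
with `T_q F = c_q F` for EVERY prime `q` (`T_q = U_q` when `q ∣ N`) and `c_q ≡ a_q(f)` modulo the
maximal ideal of `𝒪_{ℚ̄_p}` (read through `ι⁻¹`).  Proof: as `exists_isNewform0_dvd_level_congr`
(`f · E_w` is a mod-`𝔪` eigenvector of every `T_q`, the weight entering the `q`-expansion of `T_q`
only through `q^{k−1}` for `q ∤ N` and not at all for `q ∣ N`; Deligne–Serre lifting 6.11 inside
`S_{k₀+w}(N, 𝟙)`), followed by the descent of the lifted eigenform from `Γ₁(N)` with trivial
nebentypus to `Γ₀(N)` (`exists_liftToGamma1_eq_of_forall_diamondOp_eq`, `heckeT_liftToGamma1`)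
INSTEAD of the passage to the newform behind it. [cite: DeligneSerreASENS1974, 6.9–6.11]
[cite: DiamondShurman2005, §5.2 p. 169 and Exercise 5.2.4] -/
theorem exists_eigenform0_congr_of_isNewform0 (ι : PadicAlgCl p ≃+* ℂ) {N : ℕ} [NeZero N]
    {k₀ : ℤ} (hk₀ : 2 ≤ k₀) {f : CuspForm (Gamma0 N) k₀} (hf : IsNewform0 f)
    {w : ℕ} (hw3 : 3 ≤ w) (hwe : Even w) (hpw : (p - 1) ∣ w) :
    ∃ (F : CuspForm (Gamma0 N) (k₀ + w)) (c : ℕ → ℂ), F ≠ 0 ∧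
      (∀ (q : ℕ) (hq : q.Prime),
        (haveI : NeZero q := ⟨hq.ne_zero⟩; heckeT (Gamma0 N) (k₀ + w) q F) = c q • F) ∧
      ∀ q : ℕ, q.Prime → ‖ι.symm (c q) - ι.symm ((qExpansion 1 ⇑f).coeff q)‖ < 1 := by
  classical
  have hp : p.Prime := Fact.out
  have hK1 : (1 : ℤ) ≤ k₀ + w := by omega
  have h1N := HeckeTGamma1.one_mem_strictPeriods_Gamma1 N
  -- ### the Eisenstein series `E_w ≡ 1 (mod p)` and the form `x = f · E_w ∈ S_{k₀+w}(N, 𝟙)`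
  set E := ModularForm.E hw3 with hEdef
  obtain ⟨hE0, hEm⟩ := DeligneSerre1974.eisenstein_qExpansion_congr_one (ℓ := p) hw3 hwe hpw
  set f₁ : CuspForm (Gamma1 N) k₀ := liftToGamma1 N k₀ f with hf₁def
  have hf₁ : ∀ n, cuspCoeff f₁ n = (qExpansion 1 ⇑f).coeff n := fun n ↦ by
    change (qExpansion 1 ⇑(liftToGamma1 N k₀ f)).coeff n = _
    rw [coe_liftToGamma1_holds N k₀ f]
  let x : CuspForm (Gamma1 N) (k₀ + w) := f₁.mulModularForm (ofLevelOne (Gamma1 N) E)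
  have hxq : qExpansion 1 ⇑x = qExpansion 1 ⇑f₁ * qExpansion 1 ⇑E :=
    qExpansion_mulModularForm_ofLevelOne E f₁
  have hxmul : ∀ m, cuspCoeff x m = ∑ ij ∈ Finset.HasAntidiagonal.antidiagonal m,
      cuspCoeff f₁ ij.1 * (qExpansion 1 ⇑E).coeff ij.2 := fun m ↦ by
    change (qExpansion 1 ⇑x).coeff m = _
    rw [hxq, PowerSeries.coeff_mul]
    rfl
  -- ### norms: `a_n(f)` integral, `e_j ∈ 𝔪` for `j ≠ 0`
  set A : ℕ → PadicAlgCl p := fun n ↦ ι.symm ((qExpansion 1 ⇑f).coeff n) with hA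
  have hAint : ∀ n, ‖A n‖ ≤ 1 := fun n ↦
    norm_le_one_of_isIntegral ((IsNewform0.isIntegral_coeff_holds hf n).map
      (ι.symm : ℂ →+* PadicAlgCl p).toIntAlgHom)
  have hEnorm : ∀ j, j ≠ 0 → ‖ι.symm ((qExpansion 1 ⇑E).coeff j)‖ < 1 := by
    intro j hj
    obtain ⟨r, hr, hrj⟩ := hEm j hj
    rw [hrj, map_ratCast]
    exact norm_ratCast_lt_one hr
  -- ### `x ≡ f`: `‖ι⁻¹ a_m(x) - ι⁻¹ a_m(f)‖ < 1`, `‖ι⁻¹ a_m(x)‖ ≤ 1`, `a_1(x) ≡ 1`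
  have hxf : ∀ m, ‖ι.symm (cuspCoeff x m) - A m‖ < 1 := by
    intro m
    have hmem : (m, 0) ∈ Finset.HasAntidiagonal.antidiagonal m := by simp
    rw [hxmul, ← Finset.add_sum_erase _ _ hmem, hE0, mul_one, hf₁, map_add, hA,
      add_sub_cancel_left, map_sum]
    refine norm_sum_lt_one _ _ fun ij hij ↦ ?_
    obtain ⟨hne, hij'⟩ := Finset.mem_erase.mp hij
    have hj : ij.2 ≠ 0 := by
      intro h
      apply hne
      have := Finset.HasAntidiagonal.mem_antidiagonal.mp hij'
      rw [h, add_zero] at this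
      exact Prod.ext this h
    rw [map_mul, hf₁, norm_mul]
    exact mul_lt_one_of_nonneg_of_lt_one_right (hAint _) (norm_nonneg _) (hEnorm _ hj)
  have hxint : ∀ m, ‖ι.symm (cuspCoeff x m)‖ ≤ 1 := fun m ↦ by
    have h1 : ι.symm (cuspCoeff x m) = (ι.symm (cuspCoeff x m) - A m) + A m := by ring
    rw [h1]
    exact (PadicAlgCl.isNonarchimedean p _ _).trans (max_le (hxf m).le (hAint m))
  have hA1 : A 1 = 1 := by
    rw [hA]
    change ι.symm ((qExpansion 1 ⇑f).coeff 1) = 1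
    rw [show (qExpansion 1 ⇑f).coeff 1 = 1 from hf.2.2, map_one]
  have hx1 : ‖ι.symm (cuspCoeff x 1)‖ = 1 :=
    norm_eq_one_of_norm_sub_lt_one (y := A 1) (by rw [hA1, norm_one]) (hxf 1)
  -- ### `x ∈ S_{k₀+w}(N, 𝟙)`
  have hxW : x ∈ nebentypusSubspace N (k₀ + w) 1 := by
    rw [mem_nebentypusSubspace_iff_diamondOp]
    intro d
    change diamondOp N (k₀ + (w : ℤ)) d (f₁.mulModularForm (ofLevelOne (Gamma1 N) E)) = _
    rw [diamondOp_mulModularForm_ofLevelOne E (d : ZMod N) f₁, hf₁def,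
      diamondOp_liftToGamma1 N k₀ (d : ZMod N) f, MulChar.one_apply_coe, one_smul]
  have hxdiam : ∀ d : (ZMod N)ˣ, diamondOp N (k₀ + w) (d : ZMod N) x = x := fun d ↦ by
    have h := (mem_nebentypusSubspace_iff_diamondOp.mp hxW) d
    rwa [MulChar.one_apply_coe, one_smul] at h
  -- ### the Hecke relations of `f` (Diamond–Shurman Prop. 5.8.5) read in `ℚ̄_p`
  -- exponents: `k₀ - 1 = e₀`, `k₀ + w - 1 = e₀ + w`
  obtain ⟨e₀, he₀⟩ : ∃ e₀ : ℕ, k₀ - 1 = (e₀ : ℤ) := ⟨(k₀ - 1).toNat, by omega⟩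
  have he₀1 : 1 ≤ e₀ := by omega
  have hzpow₀ : ∀ q : ℕ, (q : ℂ) ^ (k₀ - 1) = ((q ^ e₀ : ℕ) : ℂ) := fun q ↦ by
    rw [he₀, zpow_natCast, Nat.cast_pow]
  have hzpow : ∀ q : ℕ, (q : ℂ) ^ (k₀ + (w : ℤ) - 1) = ((q ^ (e₀ + w) : ℕ) : ℂ) := fun q ↦ by
    rw [show k₀ + (w : ℤ) - 1 = ((e₀ + w : ℕ) : ℤ) by push_cast; omega, zpow_natCast,
      Nat.cast_pow]
  -- `p ∣ q^{e₀+w} - q^{e₀}` for every prime `q`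
  have hdvd : ∀ q : ℕ, q.Prime → (p : ℤ) ∣ ((q ^ (e₀ + w) : ℕ) : ℤ) - ((q ^ e₀ : ℕ) : ℤ) := by
    intro q hq
    have hfac : ((q ^ (e₀ + w) : ℕ) : ℤ) - ((q ^ e₀ : ℕ) : ℤ) =
        (q : ℤ) ^ e₀ * ((q : ℤ) ^ w - 1) := by push_cast; ring
    rw [hfac]
    by_cases hqp : q = p
    · subst hqp
      exact Dvd.dvd.mul_right (dvd_pow_self (q : ℤ) (by omega)) _
    · apply Dvd.dvd.mul_left
      have hcop : IsCoprime (q : ℤ) p := by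
        rw [Nat.isCoprime_iff_coprime]
        exact (Nat.coprime_primes hq hp).2 hqp
      obtain ⟨c, hc⟩ := hpw
      have h1 : (q : ℤ) ^ (p - 1) ≡ 1 [ZMOD p] := Int.ModEq.pow_card_sub_one_eq_one hp hcop
      have h2 : (q : ℤ) ^ w ≡ 1 [ZMOD p] := by
        rw [hc, pow_mul]
        simpa using h1.pow c
      exact (Int.ModEq.dvd h2.symm)
  have hpowdiff : ∀ q : ℕ, q.Prime →
      ‖ι.symm (((q ^ (e₀ + w) : ℕ) : ℂ)) - ι.symm (((q ^ e₀ : ℕ) : ℂ))‖ < 1 := by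
    intro q hq
    rw [map_natCast, map_natCast]
    have h := norm_intCast_lt_one_of_dvd (hdvd q hq)
    push_cast at h ⊢
    exact h
  have hpownorm : ∀ q : ℕ, ‖ι.symm (((q ^ (e₀ + w) : ℕ) : ℂ))‖ ≤ 1 := fun q ↦ by
    rw [map_natCast, ← Int.cast_natCast]
    exact DeligneSerreLift.norm_intCast_le_one _
  -- ### `(B)` `x` is an eigenvector modulo `𝔪` of every `T_q`, with eigenvalue `a_q(f)`
  have hcongT : ∀ (q : ℕ) (hq : q.Prime) (n : ℕ),
      ‖ι.symm (cuspCoeff ((haveI : NeZero q := ⟨hq.ne_zero⟩;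
          heckeT (Gamma1 N) (k₀ + w) q) x) n) - A q * ι.symm (cuspCoeff x n)‖ < 1 := by
    intro q hq n
    haveI : NeZero q := ⟨hq.ne_zero⟩
    -- `T_q` on `x` (weight `k₀ + w`)
    have hTx := cuspCoeff_heckeT_gamma1 x q hq n
    -- the relation `a_{qn}(f) = a_q a_n - …` (weight `k₀`)
    have hrel := IsNewform0.coeff_prime_mul hf hq n
    set D : ℕ → PadicAlgCl p := fun m ↦ ι.symm (cuspCoeff x m) - A m with hD
    have hDlt : ∀ m, ‖D m‖ < 1 := hxf
    have hxD : ∀ m, ι.symm (cuspCoeff x m) = A m + D m := fun m ↦ by rw [hD]; ring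
    by_cases hqN : q ∣ N
    · rw [if_pos hqN, add_zero] at hTx
      rw [if_pos hqN, sub_zero] at hrel
      -- `ι⁻¹ a_n(T_q x) - A q ι⁻¹ a_n(x) = D(qn) - A q D n`
      have e1 : ι.symm (cuspCoeff (heckeT (Gamma1 N) (k₀ + ↑w) q x) n) -
          A q * ι.symm (cuspCoeff x n) = D (q * n) - A q * D n := by
        rw [hTx, hxD, hxD n]
        have : A (q * n) = A q * A n := by
          simp only [hA]
          rw [hrel, map_mul]
        rw [this]
        ring
      rw [e1]
      refine (norm_sub_le_max' _ _).trans_lt (max_lt (hDlt _) ?_)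
      rw [norm_mul]
      exact mul_lt_one_of_nonneg_of_lt_one_right (hAint q) (norm_nonneg _) (hDlt n)
    · rw [if_neg hqN] at hTx hrel
      obtain ⟨d, hd⟩ := (ZMod.isUnit_prime_iff_not_dvd hq).mpr hqN
      have hdiag : diamondOp N (k₀ + w) (q : ZMod N) x = x := by rw [← hd]; exact hxdiam d
      rw [hdiag, hzpow q] at hTx
      rw [hzpow₀ q] at hrel
      by_cases hqn : q ∣ n
      · rw [if_pos hqn] at hTx hrel
        have e1 : ι.symm (cuspCoeff (heckeT (Gamma1 N) (k₀ + ↑w) q x) n) -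
            A q * ι.symm (cuspCoeff x n) =
            D (q * n) - A q * D n +
              (ι.symm (((q ^ (e₀ + w) : ℕ) : ℂ)) * D (n / q) +
                (ι.symm (((q ^ (e₀ + w) : ℕ) : ℂ)) - ι.symm (((q ^ e₀ : ℕ) : ℂ))) *
                  A (n / q)) := by
          rw [hTx, map_add, map_mul, hxD, hxD n, hxD (n / q)]
          have : A (q * n) = A q * A n - ι.symm (((q ^ e₀ : ℕ) : ℂ)) * A (n / q) := by
            simp only [hA]
            rw [hrel, map_sub, map_mul, map_mul]
          rw [this]
          ring
        rw [e1]
        refine (PadicAlgCl.isNonarchimedean p _ _).trans_lt (max_lt ?_ ?_)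
        · refine (norm_sub_le_max' _ _).trans_lt (max_lt (hDlt _) ?_)
          rw [norm_mul]
          exact mul_lt_one_of_nonneg_of_lt_one_right (hAint q) (norm_nonneg _) (hDlt n)
        · refine (PadicAlgCl.isNonarchimedean p _ _).trans_lt (max_lt ?_ ?_)
          · rw [norm_mul]
            exact mul_lt_one_of_nonneg_of_lt_one_right (hpownorm q) (norm_nonneg _) (hDlt _)
          · rw [norm_mul]
            exact mul_lt_one_of_nonneg_of_lt_one_left (norm_nonneg _) (hpowdiff q hq)
              (hAint _)
      · rw [if_neg hqn, mul_zero, add_zero] at hTx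
        rw [if_neg hqn, mul_zero, sub_zero] at hrel
        have e1 : ι.symm (cuspCoeff (heckeT (Gamma1 N) (k₀ + ↑w) q x) n) -
            A q * ι.symm (cuspCoeff x n) = D (q * n) - A q * D n := by
          rw [hTx, hxD, hxD n]
          have : A (q * n) = A q * A n := by
            simp only [hA]
            rw [hrel, map_mul]
          rw [this]
          ring
        rw [e1]
        refine (norm_sub_le_max' _ _).trans_lt (max_lt (hDlt _) ?_)
        rw [norm_mul]
        exact mul_lt_one_of_nonneg_of_lt_one_right (hAint q) (norm_nonneg _) (hDlt n)
  -- ### `(C)` Deligne–Serre lifting inside `S_{k₀+w}(N, 𝟙)`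
  let TL : ℕ → Module.End ℂ (CuspForm (Gamma1 N) (k₀ + w)) := fun q ↦
    if hq : q = 0 then 0 else (haveI : NeZero q := ⟨hq⟩; heckeT (Gamma1 N) (k₀ + w) q)
  have hTL : ∀ (q : ℕ) (hq : q ≠ 0),
      TL q = (haveI : NeZero q := ⟨hq⟩; heckeT (Gamma1 N) (k₀ + w) q) := fun q hq ↦ dif_neg hq
  let 𝒯 : Set (Module.End ℂ (CuspForm (Gamma1 N) (k₀ + w))) :=
    {T | ∃ q : ℕ, q.Prime ∧ T = TL q}
  have hcomm : ∀ S ∈ 𝒯, ∀ T ∈ 𝒯, Commute S T := by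
    rintro S ⟨q, hq, rfl⟩ T ⟨q', hq', rfl⟩
    rw [hTL q hq.ne_zero, hTL q' hq'.ne_zero]
    haveI : NeZero q := ⟨hq.ne_zero⟩
    haveI : NeZero q' := ⟨hq'.ne_zero⟩
    exact heckeT_comm_holds N (k₀ + w) q q'
  have hdiam : ∀ T ∈ 𝒯, ∀ d : (ZMod N)ˣ,
      Commute T (diamondOp N (k₀ + w) (d : ZMod N)) := by
    rintro T ⟨q, hq, rfl⟩ d
    rw [hTL q hq.ne_zero]
    haveI : NeZero q := ⟨hq.ne_zero⟩
    exact heckeT_diamondOp_comm_holds N (k₀ + w) q (d : ZMod N)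
  have hΛ : ∀ T ∈ 𝒯, ∀ y ∈ integralLattice1 N (k₀ + w), T y ∈ integralLattice1 N (k₀ + w) := by
    rintro T ⟨q, hq, rfl⟩ y hy
    rw [hTL q hq.ne_zero]
    haveI : NeZero q := ⟨hq.ne_zero⟩
    exact heckeT_mem_integralLattice1 hK1 hy q hq
  -- the targets: any admissible congruence class (they are unique modulo `𝔪`)
  let P : Module.End ℂ (CuspForm (Gamma1 N) (k₀ + w)) → PadicAlgCl p → Prop := fun T c ↦
    ‖c‖ ≤ 1 ∧ ∀ n, ‖ι.symm (cuspCoeff (T x) n) - c * ι.symm (cuspCoeff x n)‖ < 1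
  let a : Module.End ℂ (CuspForm (Gamma1 N) (k₀ + w)) → PadicAlgCl p := fun T ↦
    if h : ∃ c, P T c then h.choose else 0
  have haP : ∀ T c, P T c → P T (a T) := by
    intro T c hc
    have h : ∃ c, P T c := ⟨c, hc⟩
    simp only [a, dif_pos h]
    exact h.choose_spec
  have hPuniq : ∀ T c₁ c₂, P T c₁ → P T c₂ → ‖c₁ - c₂‖ < 1 := by
    intro T c₁ c₂ h₁ h₂
    have h := norm_sub_lt_one_trans (by rw [← norm_neg, neg_sub]; exact h₁.2 1) (h₂.2 1)
    rw [← sub_mul, norm_mul, hx1, mul_one] at h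
    exact h
  have hPT : ∀ (q : ℕ) (hq : q.Prime), P (TL q) (A q) := by
    intro q hq
    refine ⟨hAint q, fun n ↦ ?_⟩
    rw [hTL q hq.ne_zero]
    exact hcongT q hq n
  have ha : ∀ T ∈ 𝒯, ‖a T‖ ≤ 1 := by
    intro T hT
    by_cases h : ∃ c, P T c
    · exact (haP T _ h.choose_spec).1
    · simp only [a, dif_neg h, norm_zero]; exact zero_le_one
  have hcongr : ∀ T ∈ 𝒯, ∀ n,
      ‖ι.symm (cuspCoeff (T x) n) - a T * ι.symm (cuspCoeff x n)‖ < 1 := by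
    rintro T ⟨q, hq, rfl⟩ n
    exact (haP _ _ (hPT q hq)).2 n
  have hm : ¬ p ∣ 1 := hp.not_dvd_one
  have hχm : (1 : DirichletCharacter ℂ N) ^ 1 = 1 := pow_one 1
  obtain ⟨g₁, a', hg₁0, hg₁χ, hTg⟩ := DeligneSerreLift.exists_eigenform_of_congruence ι hK1 hm hχm
    𝒯 hcomm hdiam hΛ a ha hxW hxint hx1 hcongr
  -- eigenvalues of `g₁`
  have hmemT : ∀ (q : ℕ), q.Prime → TL q ∈ 𝒯 := fun q hq ↦ ⟨q, hq, rfl⟩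
  have ha'T : ∀ (q : ℕ), q.Prime → ‖a' (TL q) - A q‖ < 1 := by
    intro q hq
    have h1 := (hTg _ (hmemT q hq)).2.1
    have h2 := hPuniq _ _ _ (haP _ _ (hPT q hq)) (hPT q hq)
    exact norm_sub_lt_one_trans h1 h2
  have hT : ∀ (q : ℕ) (hq : q.Prime), ¬ q ∣ N →
      (haveI : NeZero q := ⟨hq.ne_zero⟩; heckeT (Gamma1 N) (k₀ + w) q) g₁ =
        ι (a' (TL q)) • g₁ := by
    intro q hq _
    rw [← hTL q hq.ne_zero]
    exact (hTg _ (hmemT q hq)).2.2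
  -- ### `(D')` descend the lifted EIGENFORM to `Γ₀(N)` (trivial nebentypus), keeping all `T_q`
  have hg₁diam : ∀ d : ZMod N, IsUnit d → diamondOp N (k₀ + w) d g₁ = g₁ := by
    intro d hd
    obtain ⟨u, rfl⟩ := hd
    have h := (mem_nebentypusSubspace_iff_diamondOp.mp hg₁χ) u
    rwa [MulChar.one_apply_coe, one_smul] at h
  obtain ⟨F, hF⟩ := exists_liftToGamma1_eq_of_forall_diamondOp_eq (k₀ + w) g₁ hg₁diam
  refine ⟨F, fun q ↦ ι (a' (TL q)), ?_, ?_, ?_⟩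
  · intro h0
    apply hg₁0
    rw [← hF, h0, map_zero]
  · intro q hq
    haveI : NeZero q := ⟨hq.ne_zero⟩
    apply liftToGamma1_injective
    rw [map_smul, hF, ← heckeT_liftToGamma1, hF, ← hTL q hq.ne_zero]
    exact (hTg _ (hmemT q hq)).2.2
  · intro q hq
    rw [RingEquiv.symm_apply_apply]
    exact ha'T q hq

end DeligneSerre

/-! ### `p`-stabilisation backwards at a level `L` with `p ‖ L` -/

section Descent

variable {L : ℕ} [NeZero L] {k : ℤ} {p : ℕ} [Fact p.Prime]

/-- **Ordinary eigenforms of weight `k > 2` at a level `L` with `p ‖ L` are `p`-old and come from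
a `p`-ordinary newform of level prime to `p`** (Hida, *Elementary Modular Iwasawa Theory*, proof
of Cor. 4.1.30 via Miyake Thm. 4.6.17 (2); Diamond–Shurman Prop. 5.6.2) — the tree's
`exists_isNewform0_of_ordinary_pStabilised` restated from the level `N·p` to any level `L` with
`p ∣ L`, `p² ∤ L` (same proof).  Let `k > 2`, `ι : ℚ̄_p ≃ ℂ`, `F ∈ S_k(Γ₀(L))`, `F ≠ 0`, with
`T_q F = a_q F` for the primes `q ∤ L` and `U_p F = u F`, `|ι⁻¹ u|_p = 1`.  Then there are
`M ∣ L` with `p ∤ M` and a newform `g ∈ S_k(Γ₀(M))` with `a_q(g) = a_q` (`q ∤ L`),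
`u² − a_p(g) u + p^{k−1} = 0` and `|ι⁻¹ a_p(g)|_p = 1`. [cite: Hida2022EMI, Cor. 4.1.30 (proof)]
[cite: DiamondShurman2005, Prop. 5.6.2] -/
theorem exists_isNewform0_of_ordinary_eigenform_of_exactly_dvd (ι : PadicAlgCl p ≃+* ℂ)
    (hpL : p ∣ L) (hp2 : ¬ p ^ 2 ∣ L) (hk : 2 < k) {F : CuspForm (Gamma0 L) k} (hF0 : F ≠ 0)
    {a : ℕ → ℂ}
    (hT : ∀ (q : ℕ) (hq : q.Prime), ¬ q ∣ L →
      (haveI : NeZero q := ⟨hq.ne_zero⟩; heckeT (Gamma0 L) k q F) = a q • F)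
    {u : ℂ} (hU : (haveI : NeZero p := ⟨(Fact.out : p.Prime).ne_zero⟩;
      heckeT (Gamma0 L) k p F) = u • F)
    (hu : ‖ι.symm u‖ = 1) :
    ∃ (M : ℕ) (_ : NeZero M) (_ : M ∣ L) (_ : ¬ p ∣ M) (g : CuspForm (Gamma0 M) k), IsNewform0 g ∧
      (∀ q : ℕ, q.Prime → ¬ q ∣ L → (qExpansion 1 ⇑g).coeff q = a q) ∧
      u ^ 2 - (qExpansion 1 ⇑g).coeff p * u + (p : ℂ) ^ (k - 1) = 0 ∧
      ‖ι.symm ((qExpansion 1 ⇑g).coeff p)‖ = 1 := by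
  -- adapted from `exists_isNewform0_of_ordinary_pStabilised` (HidaFamilyMembersProofs.lean)
  have hp : p.Prime := Fact.out
  haveI : NeZero p := ⟨hp.ne_zero⟩
  obtain ⟨M, _, hML, g, hgnew, hga, hspan⟩ := exists_isNewform0_mem_span_of_eigenpacket hF0 hT
  have hu0 : u ≠ 0 := by
    intro h0
    rw [h0, map_zero, norm_zero] at hu
    exact zero_ne_one hu
  -- ### `p ∤ M`
  have hpM : ¬ p ∣ M := by
    intro hpM
    -- `U_p = a_p(g)` on `F`, so `u = a_p(g)`, and `a_p(g)² = p^{k-2}`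
    have h1 := heckeT_eq_smul_of_mem_span_of_dvd hpM hp2 hgnew hspan
    rw [hU] at h1
    have hua : u = (qExpansion 1 ⇑g).coeff p := smul_left_injective ℂ hF0 h1
    obtain ⟨M', rfl⟩ := hpM
    have hpM' : ¬ p ∣ M' := by
      rintro ⟨M'', rfl⟩
      exact hp2 ((show p ^ 2 ∣ p * (p * M'') from ⟨M'', by ring⟩).trans hML)
    have hsq := hgnew.coeff_sq_eq_of_exactly_dvd rfl hpM'
    rw [← hua] at hsq
    -- norms: `‖ι⁻¹ u‖² = ‖p‖^{k-2} < 1`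
    obtain ⟨m, hm⟩ : ∃ m : ℕ, k - 2 = (m : ℤ) + 1 := ⟨(k - 3).toNat, by omega⟩
    have hn : ‖ι.symm u‖ ^ 2 = ‖(p : PadicAlgCl p)‖ ^ (m + 1) := by
      rw [← norm_pow, ← map_pow, hsq, hm, show ((m : ℤ) + 1) = ((m + 1 : ℕ) : ℤ) by push_cast; ring,
        zpow_natCast, map_pow, map_natCast, norm_pow]
    rw [hu, one_pow] at hn
    have hlt : ‖(p : PadicAlgCl p)‖ ^ (m + 1) < 1 :=
      pow_lt_one₀ (norm_nonneg _) norm_natCast_prime_lt_one (Nat.succ_ne_zero m)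
    rw [← hn] at hlt
    exact lt_irrefl _ hlt
  -- ### the quadratic relation
  have hquad := heckeT_heckeT_sub_add_eq_zero_of_mem_span_of_not_dvd hpM hpL hp2 hgnew hspan
  rw [hU, map_smul, hU, smul_smul, smul_smul, ← sub_smul, ← add_smul, smul_eq_zero] at hquad
  have hquad' : u ^ 2 - (qExpansion 1 ⇑g).coeff p * u + (p : ℂ) ^ (k - 1) = 0 := by
    rcases hquad with h | h
    · linear_combination h
    · exact absurd h hF0
  -- ### `a_p(g) = u + p^{k-1}/u` is a `p`-adic unit
  have hap : (qExpansion 1 ⇑g).coeff p = u + (p : ℂ) ^ (k - 1) * u⁻¹ := by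
    have h1 : (qExpansion 1 ⇑g).coeff p * u = (u + (p : ℂ) ^ (k - 1) * u⁻¹) * u := by
      rw [add_mul, inv_mul_cancel_right₀ hu0]
      linear_combination -hquad'
    exact mul_right_cancel₀ hu0 h1
  have hnorm : ‖ι.symm ((qExpansion 1 ⇑g).coeff p)‖ = 1 := by
    obtain ⟨m, hm⟩ : ∃ m : ℕ, k - 1 = (m : ℤ) + 1 := ⟨(k - 2).toNat, by omega⟩
    have hsmall : ‖ι.symm ((p : ℂ) ^ (k - 1) * u⁻¹)‖ < 1 := by
      rw [map_mul, map_inv₀, norm_mul, norm_inv, hu, inv_one, mul_one, hm,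
        show ((m : ℤ) + 1) = ((m + 1 : ℕ) : ℤ) by push_cast; ring, zpow_natCast, map_pow,
        map_natCast, norm_pow]
      exact pow_lt_one₀ (norm_nonneg _) norm_natCast_prime_lt_one (Nat.succ_ne_zero m)
    rw [hap, map_add]
    refine norm_eq_one_of_norm_sub_lt_one hu ?_
    rwa [add_sub_cancel_left]
  exact ⟨M, inferInstance, hML, hpM, g, hgnew, hga, hquad', hnorm⟩

end Descent

end Literature.NumberTheory.EllipticCurves.ModularForms

/-! ### The curve: a congruent good-ordinary member of some level `M′ ∣ N/p`, from modularity -/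

namespace Literature.NumberTheory.EllipticCurves

open Literature.NumberTheory.EllipticCurves.ModularForms

/-- **Classical members of the Hida family through a `p`-NEW weight-two point, up to the level**
(the statement of `hida_exists_congruent_ordinary_newform_of_multiplicative` with "newform of level
`N/p`" weakened to "newform of some level `M′ ∣ N/p`"), PROVED from the Modularity Theorem alone
(`exists_isNewformOf`, Breuil–Conrad–Diamond–Taylor 2001, Thm. A): for `E/ℚ` with globally minimal
equation `W` of conductor `N`, a prime `p ≥ 5` of MULTIPLICATIVE reduction and an integer `k > 2`
with `k ≡ 2 (mod p − 1)`, there are `M′ ∣ N/p` (so `p ∤ M′`), a newform `g ∈ S_k(Γ₀(M′))` and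
`ι : K_g →+* ℚ̄_p` with `|ι(a_p(g))|_p = 1` and `|ι(a_ℓ(g)) − a_ℓ(E)|_p < 1` for all primes `ℓ ∤ N`.
Proof: modularity gives the newform `f_E ∈ S_2(Γ₀(N))`, `a_ℓ(f_E) = a_ℓ(E)` at good `ℓ` and
`a_p(f_E) = ±1` (`p` multiplicative; Silverman §C.16), and `p ‖ N`; `exists_eigenform0_congr_of_isNewform0`
(Deligne–Serre with `U_p` kept, `w = k − 2`) gives an eigenform of weight `k` and level `N` with
unit `U_p`-eigenvalue `≡ a_p(E)`; `exists_isNewform0_of_ordinary_eigenform_of_exactly_dvd` (`k > 2`: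
ordinary ⇒ `p`-old) gives the newform `g` of level `M′ ∣ N`, `p ∤ M′`, i.e. `M′ ∣ N/p`, with unit
`a_p(g)`.  The missing step to the named fact itself — `M′ = N/p` — is the constancy of the tame
conductor along the Hida family (Hida 1986; EPW 2006, Thm. 2.2.2), `Λ`-adic and not formalised
here. [cite: DeligneSerreASENS1974, 6.9–6.11] [cite: Hida2022EMI, Cor. 4.1.30 (proof)]
[cite: EmertonPollackWeston2006, Thm. 2.1.2, §2.1 (arXiv:math/0404484 p. 7) and Ex. 5.3.1 (p. 32)]
[cite: BreuilConradDiamondTaylor2001, Thm. A] -/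
theorem exists_isNewform0_dvd_conductorNorm_div_congr_of_multiplicative_of_exists_isNewformOf
    (hmod : exists_isNewformOf) (W : WeierstrassCurve ℚ) [W.IsElliptic] [W.IsGloballyMinimal]
    (p : ℕ) [Fact p.Prime] (hp5 : 5 ≤ p) (hmult : W.HasMultiplicativeReductionAtPrime p)
    (k : ℤ) (hk : 2 < k) (hpk : ((p : ℤ) - 1) ∣ (k - 2)) :
    ∃ (M : ℕ) (_ : NeZero M) (_ : M ∣ W.conductorNorm ℤ / p) (g : CuspForm (Gamma0 M) k)
      (ι : coeffField g →+* PadicAlgCl p),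
      IsNewform0 g ∧
      ‖ι ⟨(qExpansion 1 ⇑g).coeff p, coeff_mem_coeffField g p⟩‖ = 1 ∧
      ∀ ℓ : ℕ, ℓ.Prime → ¬ ℓ ∣ W.conductorNorm ℤ →
        ‖ι ⟨(qExpansion 1 ⇑g).coeff ℓ, coeff_mem_coeffField g ℓ⟩
            - ((W.frobeniusTrace ℓ : ℤ) : PadicAlgCl p)‖ < 1 := by
  have hp : p.Prime := Fact.out
  haveI : NeZero p := ⟨hp.ne_zero⟩
  -- `N ≠ 0`, `p ‖ N`
  have hN0 : W.conductorNorm ℤ ≠ 0 := (W.conductorNorm_pos_holds).ne'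
  haveI : NeZero (W.conductorNorm ℤ) := ⟨hN0⟩
  have hfac := W.factorization_conductorNorm_eq_one_of_hasMultiplicativeReductionAtPrime p hmult
  have hpN : p ∣ W.conductorNorm ℤ := (hp.dvd_iff_one_le_factorization hN0).mpr hfac.ge
  have hp2N : ¬ p ^ 2 ∣ W.conductorNorm ℤ := by
    intro h
    have := (hp.pow_dvd_iff_le_factorization hN0).mp h
    omega
  -- the weight `k = 2 + w`, `w ≥ 3` even and divisible by `p - 1`
  obtain ⟨w, rfl⟩ : ∃ w : ℕ, k = 2 + (w : ℤ) := ⟨(k - 2).toNat, by omega⟩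
  have hpw : (p - 1) ∣ w := by
    have h1 : ((p - 1 : ℕ) : ℤ) ∣ (w : ℤ) := by
      rw [Nat.cast_sub hp.one_le]
      simpa using hpk
    exact_mod_cast h1
  have hw0 : w ≠ 0 := by omega
  have hw3 : 3 ≤ w := by
    have := Nat.le_of_dvd (Nat.pos_of_ne_zero hw0) hpw
    omega
  have hwe : Even w :=
    (even_iff_two_dvd.mp (hp.even_sub_one (by omega))).trans hpw |> even_iff_two_dvd.mpr
  -- modularity: the newform `f_E`, `a_ℓ(f_E) = a_ℓ(E)` at good `ℓ`, `a_p(f_E) = ±1`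
  obtain ⟨f, hf⟩ := hmod W
  have hfℓ : ∀ (ℓ : ℕ) [Fact ℓ.Prime], W.HasGoodReductionAtPrime ℓ →
      (qExpansion 1 ⇑f).coeff ℓ = (W.frobeniusTrace ℓ : ℂ) := by
    intro ℓ _ hℓ
    rw [← WeierstrassCurve.LFunction_apply_prime_eq_frobeniusTrace W ℓ hℓ]
    exact hf.2 ℓ
  have hfp : (qExpansion 1 ⇑f).coeff p = 1 ∨ (qExpansion 1 ⇑f).coeff p = -1 := by
    by_cases hs : W.HasSplitMultiplicativeReductionAtPrime p
    · exact Or.inl (hf.cuspCoeff_eq_one_and_sq_of_split hs).1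
    · exact Or.inr (hf.cuspCoeff_eq_neg_one_and_dvd_of_nonsplit hmult hs).1
  -- an abstract field isomorphism `ℚ̄_p ≃ ℂ`
  obtain ⟨ι₀⟩ := PadicAlgCl.nonempty_ringEquiv_complex p
  have hιfp : ‖ι₀.symm ((qExpansion 1 ⇑f).coeff p)‖ = 1 := by
    rcases hfp with h | h
    · rw [h, map_one, norm_one]
    · rw [h, map_neg, map_one, norm_neg, norm_one]
  -- the Deligne–Serre eigenform of weight `2 + w` and level `N`, all `T_q` kept
  obtain ⟨F, c, hF0, hTF, hcong⟩ := exists_eigenform0_congr_of_isNewform0 ι₀ le_rfl hf.1 hw3 hwe hpw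
  -- its `U_p`-eigenvalue is a unit: `c_p ≡ a_p(f_E) = ±1`
  have hu : ‖ι₀.symm (c p)‖ = 1 := ModularForms.norm_eq_one_of_norm_sub_lt_one hιfp (hcong p hp)
  -- `p`-stabilisation backwards: the newform `g` of level `M ∣ N`, `p ∤ M`
  obtain ⟨M, _, hMN, hpM, g, hgnew, hga, -, hnorm⟩ :=
    exists_isNewform0_of_ordinary_eigenform_of_exactly_dvd ι₀ hpN hp2N (by omega) hF0
      (fun q hq hqN ↦ hTF q hq) (hTF p hp) hu
  -- `M ∣ N/p`
  have hMNp : M ∣ W.conductorNorm ℤ / p := by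
    have hcop : Nat.Coprime M p := (Nat.coprime_comm.mp ((hp.coprime_iff_not_dvd).mpr hpM))
    have h1 : M ∣ W.conductorNorm ℤ / p * p := by rwa [Nat.div_mul_cancel hpN]
    exact hcop.dvd_of_dvd_mul_right h1
  let ι : coeffField g →+* PadicAlgCl p :=
    (ι₀.symm : ℂ →+* PadicAlgCl p).comp (algebraMap (coeffField g) ℂ)
  have hι : ∀ (x : ℂ) (hx : x ∈ coeffField g), ι ⟨x, hx⟩ = ι₀.symm x := fun _ _ ↦ rfl
  refine ⟨M, inferInstance, hMNp, g, ι, hgnew, by rw [hι]; exact hnorm, fun ℓ hℓ hℓN ↦ ?_⟩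
  haveI : Fact ℓ.Prime := ⟨hℓ⟩
  have hgoodℓ : W.HasGoodReductionAtPrime ℓ := hasGoodReductionAtPrime_of_not_dvd_conductorNorm W hℓN
  rw [hι, hga ℓ hℓ hℓN, ← map_intCast ι₀.symm, ← hfℓ ℓ hgoodℓ]
  exact hcong ℓ hℓ

end Literature.NumberTheory.EllipticCurves

end
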